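import Summits.Schanuel.Schanuel.Theorems.DiophantineDichotomyApproximationPropertyPointAPThreeMidSmall
import Summits.Schanuel.Schanuel.Theorems.DiophantineDichotomyApproximationPropertyMidLowSmallNormalForm
import HarnessLib

/-!
# `PointAPAbsAt 3` and the crux CONDITIONALLY on the mid-low-small kernel in Q₂-NORMAL FORM (crux `ApproximationProperty`, stmt-Schanuel-6117) — record of skeleton v28b

Crux `stmt-Schanuel-6117` (`Summit.Schanuel.Schanuel.Theses.DiophantineDichotomy.ApproximationProperty`), route
`DiophantineDichotomy`, line `orbit-interpolation-determinant`, lead c14 (`prover-line-stmt-Schanuel-6117-c14-0`,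
skeleton v28b, `Cruxes/ApproximationProperty/Lines/orbit_interpolation_determinant.lean`, KERNEL-c14.md).

This file LANDS, as real theorems with ONE explicit hypothesis (no `sorry`, no definition, no named fact), the successor
of …PointAPThreeMidSmall.lean (p162641, hypothesis = v27b's open stub `pointDatum_of_midLowSmall3`) after the
Q₂-NORMAL FORM of c14 (`midLowSmall3_normalForm`, p166175; KERNEL-c13.md §2(i)(ii) made formal): in the mid-low-small
configuration the small low prime surface `Q₂ ∈ 𝔮'` of degree `a₂ ≤ Δ/M₁` forces `deg 𝔮' ≤ 2Δ·a₂ (≤ 2Δ²/M₁)` — so the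
parameter `η` of v24–v27b (`deg 𝔮' < ηΔ²`) is vacuous — and `Q₂ ∈ (Q) → a ≤ Δ/M₁`, and splits the configuration as
`(Q₂ ∈ 𝔮 ∧ deg 𝔮 ≤ 2Δ·a₂) ∨ (Q₂ ∉ 𝔮 ∧ deg 𝔭 ≤ deg 𝔮 · a₂)` (the selected small curve lies itself on the small low
surface and is `M₁`-times thinner than generic, or the bad orbit is a cut of the selected curve by the small low surface
and is `M₁`-times shorter than generic). Hence v27b's stub follows from the NORMAL-FORM stub alone
(`midLowSmall_of_midLowSmallNF`, with `η := 1`), and so do `PointAPAbsAt 3`, the `t = 3` slice and — with Philippon's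
conjecture for `n ≥ 4` — the crux (`approximationProperty_of_midLowSmallNF`, registered sub-goal). The hypothesis is the
registered OPEN stub `pointDatum_of_midLowSmall3NF` verbatim — the open content of Philippon's AP2 at `n = 3` in this
line after v28 (KERNEL-c14.md §1).

Sources: Nesterenko–Philippon (eds.), LNM 1752 (2001) Ch. 3 §4 (Prop. 4.7, 4.11), Ch. 4 §4 p. 61 (AP1/AP2); the
line's memos KERNEL-c12.md, KERNEL-c13.md, KERNEL-c14.md.
-/

set_option linter.dupNamespace false

noncomputable section

attribute [local instance] MvPolynomial.gradedAlgebra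

namespace Summit.Schanuel.Schanuel.Cruxes.ApproximationProperty.OrbitInterpolationDeterminant

open Summit.Schanuel.Schanuel.Theses.DiophantineDichotomy (ApproximationProperty)
open Literature.NumberTheory.Transcendental.Nesterenko MvPolynomial
open scoped BigOperators

/-- **v27b's mid-low-small stub from its Q₂-normal form** (`midLowSmall_of_midLowSmallNF`, registered sub-goal):
given the normal-form kernel (hypothesis = registered open stub `pointDatum_of_midLowSmall3NF` verbatim), v27b's
`pointDatum_of_midLowSmall3` holds — take the hypothesis' constants with `η := 1` (the degree hypothesis
`deg 𝔮' < ηΔ²` is not used), unpack the datum and the low-small-surface hypothesis, derive the three normal-form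
conjuncts by the landed `midLowSmall3_normalForm` (`Q, P ∈ 𝔮'` from `(Q, P, T) ≤ 𝔮'`, `𝔮' ≤ 𝔭` from `𝔮' < 𝔭`) and
feed the hypothesis. [folklore] -/
theorem midLowSmall_of_midLowSmallNF : (∀ (ω : Fin 3 → ℂ) (c₁ : ℝ), 1 ≤ c₁ → ∃ δstar : ℕ, 1 ≤ δstar ∧ ∃ K₀ : ℕ, 1 ≤ K₀ ∧ ∃ C₄ : ℝ, c₁ ≤ C₄ ∧ ∃ M₁ : ℝ, 64 * c₁ ≤ M₁ ∧ ∃ lam : ℝ, 1 ≤ lam ∧ ∃ c : ℝ, c₁ ≤ c ∧ ∀ Δ Y : ℝ, c ≤ Δ → Δ ≤ Y → ∀ (Q : Rx 3) (a : ℕ) (P : Rx 3) (b : ℕ) (𝔮 : Ideal (Rx 3)) (T : Rx 3) (τ : ℕ) (𝔭 𝔮' : Ideal (Rx 3)), CycleAP3Datum ω c₁ Δ (lam * Y) Q a P b 𝔮 T τ 𝔭 → 𝔮'.IsPrime → 𝔮'.IsHomogeneous (homogeneousSubmodule (Fin (3 + 1)) ℚ) → IsUnmixedOfRank 𝔮'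 2 → 𝔮' ∈ (Ideal.span {Q} ⊔ Ideal.span {P}).minimalPrimes → Ideal.span {Q} ⊔ Ideal.span {P} ⊔ Ideal.span {T} ≤ 𝔮' → 𝔮' < 𝔭 → δstar < ideg 𝔮' 2 → a + b + ⌊Δ⌋₊ ≤ τ → Module.finrank ℚ ↥(homogeneousSubmodule (Fin (3 + 1)) ℚ τ) < Module.finrank ℚ ↥(homogeneousSubmodule (Fin (3 + 1)) ℚ τ ⊓ 𝔮'.restrictScalars ℚ) + 2 * ⌊Δ⌋₊ * ideg 𝔮 2 → ⌊c₁ * Δ⌋₊ + 1 < ideg 𝔭 1 → ¬ (Module.finrank ℚ ↥(homogeneousSubmodule (Fin (3 + 1)) ℚ ⌊c₁ * Δ⌋₊) = Module.finrank ℚ ↥(homogeneousSubmodule (Fin (3 + 1)) ℚ ⌊c₁ * Δ⌋₊ ⊓ 𝔭.restrictScalars ℚ) + ideg 𝔭 1) → homogeneousSubmodule (Fin (3 + 1)) ℚ ⌊C₄ * Δ⌋₊ ⊓ 𝔭.restrictScalars ℚ ≤ 𝔮'.restrictScalars ℚ → K₀ * Module.finrank ℚ ↥(homogeneousSubmodule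 (Fin (3 + 1)) ℚ ⌊C₄ * Δ⌋₊) < ideg 𝔭 1 + K₀ * Module.finrank ℚ ↥(homogeneousSubmodule (Fin (3 + 1)) ℚ ⌊C₄ * Δ⌋₊ ⊓ 𝔭.restrictScalars ℚ) → (∃ (F Q₂ : Rx 3) (d a₂ : ℕ), F ≠ 0 ∧ F.IsHomogeneous d ∧ 1 ≤ d ∧ (d : ℝ) ≤ Δ / M₁ ∧ height F ≤ lam * Y / c₁ ∧ Q₂ ≠ 0 ∧ Q₂.IsHomogeneous a₂ ∧ 1 ≤ a₂ ∧ a₂ ≤ d ∧ (Ideal.span {Q₂}).IsPrime ∧ Q₂ ∣ F ∧ Q₂ ∈ 𝔮' ∧ height Q₂ ≤ lam * Y / c₁ + 4 * Δ / M₁ ∧ normAt (Fin.cons 1 ω) Q₂ ≤ Real.exp (-((a₂ : ℝ) * (Δ / M₁) ^ 2 * (lam * Y) / (3200 * c₁))) ∧ (ideg 𝔮' 2 : ℝ) ≤ 2 * Δ * a₂ ∧ (Q₂ ∈ Ideal.span {Q} → (a : ℝ) ≤ Δ / M₁) ∧ ((Q₂ ∈ 𝔮 ∧ (ideg 𝔮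 2 : ℝ) ≤ 2 * Δ * a₂) ∨ (Q₂ ∉ 𝔮 ∧ ideg 𝔭 1 ≤ ideg 𝔮 2 * a₂))) → ∃ (K : Type) (_ : Field K) (_ : NumberField K) (β : Fin 3 → K) (σ : K →+* ℂ), (Module.finrank ℚ K : ℝ) ≤ (c * Δ) ^ 3 ∧ Height.logHeight (Fin.cons (1 : K) β : Fin (3 + 1) → K) ≤ c * Y * Δ ^ 2 ∧ ‖(fun j => σ (β j)) - ω‖ ≤ Real.exp (-((Δ * Height.logHeight (Fin.cons (1 : K) β : Fin (3 + 1) → K) + Y * Module.finrank ℚ K) / c))) → (∀ (ω : Fin 3 → ℂ) (c₁ : ℝ), 1 ≤ c₁ → ∃ δstar : ℕ, 1 ≤ δstar ∧ ∃ K₀ : ℕ, 1 ≤ K₀ ∧ ∃ C₄ : ℝ, c₁ ≤ C₄ ∧ ∃ η : ℝ, 0 < η ∧ ∃ M₁ : ℝ, 64 * c₁ ≤ M₁ ∧ ∃ lam : ℝ, 1 ≤ lam ∧ ∃ c : ℝ, c₁ ≤ c ∧ ∀ Δ Y : ℝ, c ≤ Δ → Δ ≤ Y → ∀ (Q : Rx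 3) (a : ℕ) (P : Rx 3) (b : ℕ) (𝔮 : Ideal (Rx 3)) (T : Rx 3) (τ : ℕ) (𝔭 𝔮' : Ideal (Rx 3)), CycleAP3Datum ω c₁ Δ (lam * Y) Q a P b 𝔮 T τ 𝔭 → 𝔮'.IsPrime → 𝔮'.IsHomogeneous (homogeneousSubmodule (Fin (3 + 1)) ℚ) → IsUnmixedOfRank 𝔮' 2 → 𝔮' ∈ (Ideal.span {Q} ⊔ Ideal.span {P}).minimalPrimes → Ideal.span {Q} ⊔ Ideal.span {P} ⊔ Ideal.span {T} ≤ 𝔮' → 𝔮' < 𝔭 → δstar < ideg 𝔮' 2 → a + b + ⌊Δ⌋₊ ≤ τ → Module.finrank ℚ ↥(homogeneousSubmodule (Fin (3 + 1)) ℚ τ) < Module.finrank ℚ ↥(homogeneousSubmodule (Fin (3 + 1)) ℚ τ ⊓ 𝔮'.restrictScalars ℚ) + 2 * ⌊Δ⌋₊ * ideg 𝔮 2 → ⌊c₁ * Δ⌋₊ + 1 < ideg 𝔭 1 → ¬ (Module.finrank ℚ ↥(homogeneousSubmodule (Fin (3 + 1)) ℚ ⌊c₁ * Δ⌋₊) =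 Module.finrank ℚ ↥(homogeneousSubmodule (Fin (3 + 1)) ℚ ⌊c₁ * Δ⌋₊ ⊓ 𝔭.restrictScalars ℚ) + ideg 𝔭 1) → homogeneousSubmodule (Fin (3 + 1)) ℚ ⌊C₄ * Δ⌋₊ ⊓ 𝔭.restrictScalars ℚ ≤ 𝔮'.restrictScalars ℚ → K₀ * Module.finrank ℚ ↥(homogeneousSubmodule (Fin (3 + 1)) ℚ ⌊C₄ * Δ⌋₊) < ideg 𝔭 1 + K₀ * Module.finrank ℚ ↥(homogeneousSubmodule (Fin (3 + 1)) ℚ ⌊C₄ * Δ⌋₊ ⊓ 𝔭.restrictScalars ℚ) → (ideg 𝔮' 2 : ℝ) < η * Δ ^ 2 → (∃ (F Q₂ : Rx 3) (d a₂ : ℕ), F ≠ 0 ∧ F.IsHomogeneous d ∧ 1 ≤ d ∧ (d : ℝ) ≤ Δ / M₁ ∧ height F ≤ lam * Y / c₁ ∧ Q₂ ≠ 0 ∧ Q₂.IsHomogeneous a₂ ∧ 1 ≤ a₂ ∧ a₂ ≤ d ∧ (Ideal.span {Q₂}).IsPrime ∧ Q₂ ∣ F ∧ Q₂ ∈ 𝔮'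 ∧ height Q₂ ≤ lam * Y / c₁ + 4 * Δ / M₁ ∧ normAt (Fin.cons 1 ω) Q₂ ≤ Real.exp (-((a₂ : ℝ) * (Δ / M₁) ^ 2 * (lam * Y) / (3200 * c₁)))) → ∃ (K : Type) (_ : Field K) (_ : NumberField K) (β : Fin 3 → K) (σ : K →+* ℂ), (Module.finrank ℚ K : ℝ) ≤ (c * Δ) ^ 3 ∧ Height.logHeight (Fin.cons (1 : K) β : Fin (3 + 1) → K) ≤ c * Y * Δ ^ 2 ∧ ‖(fun j => σ (β j)) - ω‖ ≤ Real.exp (-((Δ * Height.logHeight (Fin.cons (1 : K) β : Fin (3 + 1) → K) + Y * Module.finrank ℚ K) / c))) := by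
  intro hnf0 ω c₁ hc₁
  obtain ⟨δstar, hδ, K₀, hK₀, C₄, hC₄, M₁, hM₁, lam, hlam, c, hc, hnf⟩ := hnf0 ω c₁ hc₁
  refine ⟨δstar, hδ, K₀, hK₀, C₄, hC₄, 1, one_pos, M₁, hM₁, lam, hlam, c, hc, ?_⟩
  intro Δ Y hΔ hY Q a P b 𝔮 T τ 𝔭 𝔮' hdat h1 h2 h3 h4 h5 h6 h7 h8 h9 h10 h11 h12 h13 _hcase hlow
  obtain ⟨F, Q₂, d, a₂, hF0, hFhom, hd1, hdM, hFh, hQ₂0, hQ₂hom, ha₂1, ha₂d, hQ₂p, hdvd, hQ₂𝔮', hQ₂h, hQ₂small⟩ :=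
    hlow
  obtain ⟨hQ0, hQhom, ha1, haΔ, hQprime, hPhom, hb1, hbΔ, hPQ, h𝔮p, h𝔮h, h𝔮u, hQ𝔮, hP𝔮, -, -, -, -, -, -, -,
    h𝔭p, h𝔭h, h𝔭u, h𝔮𝔭, -, -, -, -, -⟩ := id hdat
  have hQ𝔮' : Q ∈ 𝔮' := h5 (Ideal.mem_sup_left (Ideal.mem_sup_left (Ideal.mem_span_singleton_self Q)))
  have hP𝔮' : P ∈ 𝔮' := h5 (Ideal.mem_sup_left (Ideal.mem_sup_right (Ideal.mem_span_singleton_self P)))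
  obtain ⟨hδ', hassoc, hsplit⟩ := midLowSmall3_normalForm Δ M₁ Q a P b 𝔮 𝔭 𝔮' Q₂ a₂ d hQ0 hQhom ha1 haΔ
    hQprime hPhom hb1 hbΔ hPQ h𝔮p h𝔮h h𝔮u hQ𝔮 hP𝔮 h𝔭p h𝔭h h𝔭u h𝔮𝔭 h1 h2 h3 hQ𝔮' hP𝔮' h6.le hQ₂0 hQ₂hom ha₂1
    ha₂d hdM hQ₂𝔮'
  exact hnf Δ Y hΔ hY Q a P b 𝔮 T τ 𝔭 𝔮' hdat h1 h2 h3 h4 h5 h6 h7 h8 h9 h10 h11 h12 h13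
    ⟨F, Q₂, d, a₂, hF0, hFhom, hd1, hdM, hFh, hQ₂0, hQ₂hom, ha₂1, ha₂d, hQ₂p, hdvd, hQ₂𝔮', hQ₂h, hQ₂small, hδ',
      hassoc, hsplit⟩

/-- **`PointAPAbsAt 3` from the normal-form kernel** (landed `pointAPAt3_of_midLowSmall` over
`midLowSmall_of_midLowSmallNF`). [folklore] -/
theorem pointAPAt3_of_midLowSmallNF : (∀ (ω : Fin 3 → ℂ) (c₁ : ℝ), 1 ≤ c₁ → ∃ δstar : ℕ, 1 ≤ δstar ∧ ∃ K₀ : ℕ, 1 ≤ K₀ ∧ ∃ C₄ : ℝ, c₁ ≤ C₄ ∧ ∃ M₁ : ℝ, 64 * c₁ ≤ M₁ ∧ ∃ lam : ℝ, 1 ≤ lam ∧ ∃ c : ℝ, c₁ ≤ c ∧ ∀ Δ Y : ℝ, c ≤ Δ → Δ ≤ Y → ∀ (Q : Rx 3) (a : ℕ) (P : Rx 3) (b : ℕ) (𝔮 : Ideal (Rx 3)) (T : Rx 3) (τ : ℕ) (𝔭 𝔮' : Ideal (Rx 3)), CycleAP3Datum ω c₁ Δ (lam * Y) Q a P b 𝔮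 T τ 𝔭 → 𝔮'.IsPrime → 𝔮'.IsHomogeneous (homogeneousSubmodule (Fin (3 + 1)) ℚ) → IsUnmixedOfRank 𝔮' 2 → 𝔮' ∈ (Ideal.span {Q} ⊔ Ideal.span {P}).minimalPrimes → Ideal.span {Q} ⊔ Ideal.span {P} ⊔ Ideal.span {T} ≤ 𝔮' → 𝔮' < 𝔭 → δstar < ideg 𝔮' 2 → a + b + ⌊Δ⌋₊ ≤ τ → Module.finrank ℚ ↥(homogeneousSubmodule (Fin (3 + 1)) ℚ τ) < Module.finrank ℚ ↥(homogeneousSubmodule (Fin (3 + 1)) ℚ τ ⊓ 𝔮'.restrictScalars ℚ) + 2 * ⌊Δ⌋₊ * ideg 𝔮 2 → ⌊c₁ * Δ⌋₊ + 1 < ideg 𝔭 1 → ¬ (Module.finrank ℚ ↥(homogeneousSubmodule (Fin (3 + 1)) ℚ ⌊c₁ * Δ⌋₊) = Module.finrank ℚ ↥(homogeneousSubmodule (Fin (3 + 1)) ℚ ⌊c₁ * Δ⌋₊ ⊓ 𝔭.restrictScalars ℚ) + ideg 𝔭 1) → homogeneousSubmodule (Fin (3 + 1)) ℚ ⌊C₄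 * Δ⌋₊ ⊓ 𝔭.restrictScalars ℚ ≤ 𝔮'.restrictScalars ℚ → K₀ * Module.finrank ℚ ↥(homogeneousSubmodule (Fin (3 + 1)) ℚ ⌊C₄ * Δ⌋₊) < ideg 𝔭 1 + K₀ * Module.finrank ℚ ↥(homogeneousSubmodule (Fin (3 + 1)) ℚ ⌊C₄ * Δ⌋₊ ⊓ 𝔭.restrictScalars ℚ) → (∃ (F Q₂ : Rx 3) (d a₂ : ℕ), F ≠ 0 ∧ F.IsHomogeneous d ∧ 1 ≤ d ∧ (d : ℝ) ≤ Δ / M₁ ∧ height F ≤ lam * Y / c₁ ∧ Q₂ ≠ 0 ∧ Q₂.IsHomogeneous a₂ ∧ 1 ≤ a₂ ∧ a₂ ≤ d ∧ (Ideal.span {Q₂}).IsPrime ∧ Q₂ ∣ F ∧ Q₂ ∈ 𝔮' ∧ height Q₂ ≤ lam * Y / c₁ + 4 * Δ / M₁ ∧ normAt (Fin.cons 1 ω) Q₂ ≤ Real.exp (-((a₂ : ℝ) * (Δ / M₁) ^ 2 * (lam * Y) / (3200 * c₁))) ∧ (ideg 𝔮' 2 : ℝ) ≤ 2 * Δ *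 a₂ ∧ (Q₂ ∈ Ideal.span {Q} → (a : ℝ) ≤ Δ / M₁) ∧ ((Q₂ ∈ 𝔮 ∧ (ideg 𝔮 2 : ℝ) ≤ 2 * Δ * a₂) ∨ (Q₂ ∉ 𝔮 ∧ ideg 𝔭 1 ≤ ideg 𝔮 2 * a₂))) → ∃ (K : Type) (_ : Field K) (_ : NumberField K) (β : Fin 3 → K) (σ : K →+* ℂ), (Module.finrank ℚ K : ℝ) ≤ (c * Δ) ^ 3 ∧ Height.logHeight (Fin.cons (1 : K) β : Fin (3 + 1) → K) ≤ c * Y * Δ ^ 2 ∧ ‖(fun j => σ (β j)) - ω‖ ≤ Real.exp (-((Δ * Height.logHeight (Fin.cons (1 : K) β : Fin (3 + 1) → K) + Y * Module.finrank ℚ K) / c))) → PointAPAbsAt 3 :=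
  fun hnf => pointAPAt3_of_midLowSmall (midLowSmall_of_midLowSmallNF hnf)

/-- **The `t = 3` slice of the crux from the normal-form kernel ALONE** (landed `slice_three_of_midLowSmall`).
[folklore] -/
theorem slice_three_of_midLowSmallNF : (∀ (ω : Fin 3 → ℂ) (c₁ : ℝ), 1 ≤ c₁ → ∃ δstar : ℕ, 1 ≤ δstar ∧ ∃ K₀ : ℕ, 1 ≤ K₀ ∧ ∃ C₄ : ℝ, c₁ ≤ C₄ ∧ ∃ M₁ : ℝ, 64 * c₁ ≤ M₁ ∧ ∃ lam : ℝ, 1 ≤ lam ∧ ∃ c : ℝ, c₁ ≤ c ∧ ∀ Δ Y : ℝ, c ≤ Δ → Δ ≤ Y → ∀ (Q : Rx 3) (a : ℕ) (P : Rx 3) (b : ℕ) (𝔮 : Ideal (Rx 3)) (T : Rx 3) (τ : ℕ) (𝔭 𝔮' : Ideal (Rx 3)), CycleAP3Datum ω c₁ Δ (lam * Y) Q a P b 𝔮 T τ 𝔭 → 𝔮'.IsPrime → 𝔮'.IsHomogeneous (homogeneousSubmodule (Fin (3 + 1)) ℚ) → IsUnmixedOfRank 𝔮' 2 → 𝔮'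 ∈ (Ideal.span {Q} ⊔ Ideal.span {P}).minimalPrimes → Ideal.span {Q} ⊔ Ideal.span {P} ⊔ Ideal.span {T} ≤ 𝔮' → 𝔮' < 𝔭 → δstar < ideg 𝔮' 2 → a + b + ⌊Δ⌋₊ ≤ τ → Module.finrank ℚ ↥(homogeneousSubmodule (Fin (3 + 1)) ℚ τ) < Module.finrank ℚ ↥(homogeneousSubmodule (Fin (3 + 1)) ℚ τ ⊓ 𝔮'.restrictScalars ℚ) + 2 * ⌊Δ⌋₊ * ideg 𝔮 2 → ⌊c₁ * Δ⌋₊ + 1 < ideg 𝔭 1 → ¬ (Module.finrank ℚ ↥(homogeneousSubmodule (Fin (3 + 1)) ℚ ⌊c₁ * Δ⌋₊) = Module.finrank ℚ ↥(homogeneousSubmodule (Fin (3 + 1)) ℚ ⌊c₁ * Δ⌋₊ ⊓ 𝔭.restrictScalars ℚ) + ideg 𝔭 1) → homogeneousSubmodule (Fin (3 + 1)) ℚ ⌊C₄ * Δ⌋₊ ⊓ 𝔭.restrictScalars ℚ ≤ 𝔮'.restrictScalars ℚ → K₀ * Module.finrank ℚ ↥(homogeneousSubmodule (Fin (3 + 1))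 ℚ ⌊C₄ * Δ⌋₊) < ideg 𝔭 1 + K₀ * Module.finrank ℚ ↥(homogeneousSubmodule (Fin (3 + 1)) ℚ ⌊C₄ * Δ⌋₊ ⊓ 𝔭.restrictScalars ℚ) → (∃ (F Q₂ : Rx 3) (d a₂ : ℕ), F ≠ 0 ∧ F.IsHomogeneous d ∧ 1 ≤ d ∧ (d : ℝ) ≤ Δ / M₁ ∧ height F ≤ lam * Y / c₁ ∧ Q₂ ≠ 0 ∧ Q₂.IsHomogeneous a₂ ∧ 1 ≤ a₂ ∧ a₂ ≤ d ∧ (Ideal.span {Q₂}).IsPrime ∧ Q₂ ∣ F ∧ Q₂ ∈ 𝔮' ∧ height Q₂ ≤ lam * Y / c₁ + 4 * Δ / M₁ ∧ normAt (Fin.cons 1 ω) Q₂ ≤ Real.exp (-((a₂ : ℝ) * (Δ / M₁) ^ 2 * (lam * Y) / (3200 * c₁))) ∧ (ideg 𝔮' 2 : ℝ) ≤ 2 * Δ * a₂ ∧ (Q₂ ∈ Ideal.span {Q} → (a : ℝ) ≤ Δ / M₁) ∧ ((Q₂ ∈ 𝔮 ∧ (ideg 𝔮 2 : ℝ) ≤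 2 * Δ * a₂) ∨ (Q₂ ∉ 𝔮 ∧ ideg 𝔭 1 ≤ ideg 𝔮 2 * a₂))) → ∃ (K : Type) (_ : Field K) (_ : NumberField K) (β : Fin 3 → K) (σ : K →+* ℂ), (Module.finrank ℚ K : ℝ) ≤ (c * Δ) ^ 3 ∧ Height.logHeight (Fin.cons (1 : K) β : Fin (3 + 1) → K) ≤ c * Y * Δ ^ 2 ∧ ‖(fun j => σ (β j)) - ω‖ ≤ Real.exp (-((Δ * Height.logHeight (Fin.cons (1 : K) β : Fin (3 + 1) → K) + Y * Module.finrank ℚ K) / c))) → PointwiseAPSlice 3 :=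
  fun hnf => slice_three_of_midLowSmall (midLowSmall_of_midLowSmallNF hnf)

/-- **The crux from the normal-form kernel and Philippon's conjecture for `n ≥ 4`** (registered sub-goal
`approximationProperty_of_midLowSmallNF`; landed `approximationProperty_of_midLowSmall`): skeleton v28b's composition
as a theorem of the tree — `ApproximationProperty` follows from the two registered OPEN stubs
`pointDatum_of_midLowSmall3NF` and `stub_pointAP_four_le`, and from nothing else. [folklore] -/
theorem approximationProperty_of_midLowSmallNF : (∀ (ω : Fin 3 → ℂ) (c₁ : ℝ), 1 ≤ c₁ → ∃ δstar : ℕ, 1 ≤ δstar ∧ ∃ K₀ : ℕ, 1 ≤ K₀ ∧ ∃ C₄ : ℝ, c₁ ≤ C₄ ∧ ∃ M₁ : ℝ, 64 * c₁ ≤ M₁ ∧ ∃ lam : ℝ, 1 ≤ lam ∧ ∃ c : ℝ, c₁ ≤ c ∧ ∀ Δ Y : ℝ, c ≤ Δ → Δ ≤ Y → ∀ (Q : Rx 3) (a : ℕ) (P : Rx 3) (b : ℕ) (𝔮 : Ideal (Rx 3)) (T : Rx 3) (τ : ℕ) (𝔭 𝔮' : Ideal (Rx 3)), CycleAP3Datum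 ω c₁ Δ (lam * Y) Q a P b 𝔮 T τ 𝔭 → 𝔮'.IsPrime → 𝔮'.IsHomogeneous (homogeneousSubmodule (Fin (3 + 1)) ℚ) → IsUnmixedOfRank 𝔮' 2 → 𝔮' ∈ (Ideal.span {Q} ⊔ Ideal.span {P}).minimalPrimes → Ideal.span {Q} ⊔ Ideal.span {P} ⊔ Ideal.span {T} ≤ 𝔮' → 𝔮' < 𝔭 → δstar < ideg 𝔮' 2 → a + b + ⌊Δ⌋₊ ≤ τ → Module.finrank ℚ ↥(homogeneousSubmodule (Fin (3 + 1)) ℚ τ) < Module.finrank ℚ ↥(homogeneousSubmodule (Fin (3 + 1)) ℚ τ ⊓ 𝔮'.restrictScalars ℚ) + 2 * ⌊Δ⌋₊ * ideg 𝔮 2 → ⌊c₁ * Δ⌋₊ + 1 < ideg 𝔭 1 → ¬ (Module.finrank ℚ ↥(homogeneousSubmodule (Fin (3 + 1)) ℚ ⌊c₁ * Δ⌋₊) = Module.finrank ℚ ↥(homogeneousSubmodule (Fin (3 + 1)) ℚ ⌊c₁ * Δ⌋₊ ⊓ 𝔭.restrictScalars ℚ) + ideg 𝔭 1) → homogeneousSubmodule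 (Fin (3 + 1)) ℚ ⌊C₄ * Δ⌋₊ ⊓ 𝔭.restrictScalars ℚ ≤ 𝔮'.restrictScalars ℚ → K₀ * Module.finrank ℚ ↥(homogeneousSubmodule (Fin (3 + 1)) ℚ ⌊C₄ * Δ⌋₊) < ideg 𝔭 1 + K₀ * Module.finrank ℚ ↥(homogeneousSubmodule (Fin (3 + 1)) ℚ ⌊C₄ * Δ⌋₊ ⊓ 𝔭.restrictScalars ℚ) → (∃ (F Q₂ : Rx 3) (d a₂ : ℕ), F ≠ 0 ∧ F.IsHomogeneous d ∧ 1 ≤ d ∧ (d : ℝ) ≤ Δ / M₁ ∧ height F ≤ lam * Y / c₁ ∧ Q₂ ≠ 0 ∧ Q₂.IsHomogeneous a₂ ∧ 1 ≤ a₂ ∧ a₂ ≤ d ∧ (Ideal.span {Q₂}).IsPrime ∧ Q₂ ∣ F ∧ Q₂ ∈ 𝔮' ∧ height Q₂ ≤ lam * Y / c₁ + 4 * Δ / M₁ ∧ normAt (Fin.cons 1 ω) Q₂ ≤ Real.exp (-((a₂ : ℝ) * (Δ / M₁) ^ 2 * (lam * Y) / (3200 * c₁))) ∧ (ideg 𝔮'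 2 : ℝ) ≤ 2 * Δ * a₂ ∧ (Q₂ ∈ Ideal.span {Q} → (a : ℝ) ≤ Δ / M₁) ∧ ((Q₂ ∈ 𝔮 ∧ (ideg 𝔮 2 : ℝ) ≤ 2 * Δ * a₂) ∨ (Q₂ ∉ 𝔮 ∧ ideg 𝔭 1 ≤ ideg 𝔮 2 * a₂))) → ∃ (K : Type) (_ : Field K) (_ : NumberField K) (β : Fin 3 → K) (σ : K →+* ℂ), (Module.finrank ℚ K : ℝ) ≤ (c * Δ) ^ 3 ∧ Height.logHeight (Fin.cons (1 : K) β : Fin (3 + 1) → K) ≤ c * Y * Δ ^ 2 ∧ ‖(fun j => σ (β j)) - ω‖ ≤ Real.exp (-((Δ * Height.logHeight (Fin.cons (1 : K) β : Fin (3 + 1) → K) + Y * Module.finrank ℚ K) / c))) → (∀ t : ℕ, 4 ≤ t → PointAPAbsAt t) → ApproximationProperty :=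
  fun hnf h4 => approximationProperty_of_midLowSmall (midLowSmall_of_midLowSmallNF hnf) h4

end Summit.Schanuel.Schanuel.Cruxes.ApproximationProperty.OrbitInterpolationDeterminant

end
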